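import Mathlib
import Summits.KontsevichZagierPeriods.KontsevichZagierPeriods.Theorems.SoloInformedAyoubTransfer
import Summits.KontsevichZagierPeriods.KontsevichZagierPeriods.Theorems.SoloInformedNashSelection
import HarnessLib
import HarnessLib.Audit

/-!
# SoloInformed — proof of LEMMA Q and the two-hypothesis Ayoub transfer

**THEOREM (`soloInformed_ayoubLemmaQ`).** `SoloInformedAyoubLemmaQ` holds: for every Ayoub generator
`a` (a power series on a polydisc of radius `ρ > 1`, real on real points, with `P(z, a z) = 0` for a
non-zero `P ∈ ℚ[z, T]`) the function `x ↦ Re a(x)` is `ℚ`-semialgebraic on the open rational box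
`W = (-q, q)ⁿ`, `1 < q < ρ` rational, which contains `[0,1]ⁿ` and is mapped into the polydisc.

Proof: on real points `a` is real, so `P(x, Re a(x)) = 0` for `x ∈ W`; `Re a` is continuous on `W`;
apply the Nash selection theorem over `ℚ` (`soloInformed_isSemialgebraicFunOn_of_aeval_eq_zero`).

Consequently the transfer theorem needs only the two substantive hypotheses
(`soloInformed_ayoubTransfer₂`): Ayoub's conjecture for the real sub-presentation
(`SoloInformedAyoubKZeff`) and the presentation-by-moves statement (`SoloInformedAyoubPresentation`)
imply the Kontsevich–Zagier period conjecture in the form `KontsevichZagierPeriods`.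
[cite: Ayoub2014, Def. 9, Def. 10, Rem. 13] [cite: BasuPollackRoy2006, Cor. 5.7]
-/

noncomputable section

open Set Filter Topology
open Literature.ModelTheory.ExponentialFields
open Literature.NumberTheory.Transcendental (IsSemialgebraicFunOn)

namespace Summit.KontsevichZagierPeriods.KontsevichZagierPeriods.Theorems

/-- Complexification commutes with evaluation of a rational polynomial at a real point. -/
theorem soloInformed_ofReal_aeval {m : ℕ} (y : Fin m → ℝ) (P : MvPolynomial (Fin m) ℚ) :
    ((MvPolynomial.aeval y P : ℝ) : ℂ) = MvPolynomial.aeval (fun i => (y i : ℂ)) P := by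
  have h := MvPolynomial.eval₂_comp_left Complex.ofRealHom (algebraMap ℚ ℝ) y P
  have hc : Complex.ofRealHom.comp (algebraMap ℚ ℝ) = algebraMap ℚ ℂ :=
    RingHom.ext fun q => by simp
  rw [hc] at h
  simpa [MvPolynomial.aeval_def, Function.comp_def] using h

/-- The open rational box `(-q, q)ⁿ`. -/
def soloInformedBox (n : ℕ) (q : ℚ) : Set (Fin n → ℝ) :=
  {x | ∀ i, -(q : ℝ) < x i ∧ x i < q}

/-- The box is open. -/
theorem isOpen_soloInformedBox (n : ℕ) (q : ℚ) : IsOpen (soloInformedBox n q) := by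
  have h : soloInformedBox n q = ⋂ i, (fun x : Fin n → ℝ => x i) ⁻¹' Ioo (-(q : ℝ)) q := by
    ext x; simp [soloInformedBox]
  rw [h]
  exact isOpen_iInter_of_finite fun i => isOpen_Ioo.preimage (continuous_apply i)

/-- The box is `ℚ`-semialgebraic. -/
theorem isSemialgebraic_soloInformedBox (n : ℕ) (q : ℚ) :
    IsSemialgebraic ℚ (soloInformedBox n q) := by
  have h1 : IsSemialgebraic ℚ
      (⋂ i ∈ (Finset.univ : Finset (Fin n)), {t : Fin n → ℝ | -(q : ℝ) < t i}) :=
    IsSemialgebraic.biInter Finset.univ _ fun i _ => by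
      simpa using isSemialgebraic_setOf_eval_lt (k := ℚ) (R := ℝ)
        (MvPolynomial.C (-q) : MvPolynomial (Fin n) ℚ) (MvPolynomial.X i)
  have h2 : IsSemialgebraic ℚ
      (⋂ i ∈ (Finset.univ : Finset (Fin n)), {t : Fin n → ℝ | t i < q}) :=
    IsSemialgebraic.biInter Finset.univ _ fun i _ => by
      simpa using isSemialgebraic_setOf_eval_lt (k := ℚ) (R := ℝ)
        (MvPolynomial.X i : MvPolynomial (Fin n) ℚ) (MvPolynomial.C q)
  have hset : soloInformedBox n q =
      (⋂ i ∈ (Finset.univ : Finset (Fin n)), {t : Fin n → ℝ | -(q : ℝ) < t i}) ∩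
        ⋂ i ∈ (Finset.univ : Finset (Fin n)), {t : Fin n → ℝ | t i < q} := by
    ext t
    simp [soloInformedBox, forall_and]
  rw [hset]
  exact h1.inter h2

/-- The unit cube lies in the box `(-q, q)ⁿ` for `q > 1`. -/
theorem soloInformedCube_subset_box {n : ℕ} {q : ℚ} (hq : 1 < (q : ℝ)) :
    soloInformedCube n ⊆ soloInformedBox n q := fun x hx i =>
  ⟨by linarith [(soloInformed_mem_cube_iff.1 hx i).1],
    by linarith [(soloInformed_mem_cube_iff.1 hx i).2]⟩

/-- The box `(-q, q)ⁿ`, `q < ρ`, is mapped into the complex polydisc of radius `ρ`. -/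
theorem soloInformed_mapsTo_box {n : ℕ} {q : ℚ} {ρ : ℝ} (hq : 0 < (q : ℝ)) (hqρ : (q : ℝ) < ρ) :
    MapsTo (soloInformedToC n) (soloInformedBox n q) (Metric.ball 0 ρ) := by
  intro x hx
  rw [mem_ball_zero_iff]
  refine lt_of_le_of_lt ?_ hqρ
  refine (pi_norm_le_iff_of_nonneg hq.le).2 fun i => ?_
  rw [soloInformedToC_apply, Complex.norm_real, Real.norm_eq_abs]
  exact (abs_lt.2 (hx i)).le

/-- **LEMMA Q holds**: the real part of an Ayoub generator is a `ℚ`-semialgebraic function on a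
`ℚ`-semialgebraic open neighbourhood of the unit cube inside the polydisc of convergence.
[cite: Ayoub2014, Def. 9] [cite: BasuPollackRoy2006, Cor. 5.7] -/
theorem soloInformed_ayoubLemmaQ : SoloInformedAyoubLemmaQ := by
  intro n a
  obtain ⟨q, hq1, hqρ⟩ := exists_rat_btwn a.one_lt
  have hq0 : 0 < (q : ℝ) := by linarith
  have hW : MapsTo (soloInformedToC n) (soloInformedBox n q) (Metric.ball 0 a.ρ) :=
    soloInformed_mapsTo_box hq0 hqρ
  obtain ⟨P, hP0, hP⟩ := a.algebraic
  set G : (Fin n → ℝ) → ℝ := fun x => (a.f (soloInformedToC n x)).re with hG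
  have hGc : ContinuousOn G (soloInformedBox n q) :=
    Complex.continuous_re.comp_continuousOn (soloInformedAyoub_continuousOn a hW)
  have hPG : ∀ x ∈ soloInformedBox n q,
      MvPolynomial.aeval (Fin.snoc x (G x) : Fin (n + 1) → ℝ) P = 0 := by
    intro x hx
    have hv : (fun i => ((Fin.snoc x (G x) : Fin (n + 1) → ℝ) i : ℂ)) =
        Fin.snoc (soloInformedToC n x) (a.f (soloInformedToC n x)) := by
      funext i
      refine Fin.lastCases ?_ (fun j => ?_) i
      · simp only [Fin.snoc_last]
        exact Complex.ext (by simp [hG]) (by simp [a.real x (hW hx)])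
      · simp only [Fin.snoc_castSucc, soloInformedToC_apply]
    have h1 := soloInformed_ofReal_aeval (Fin.snoc x (G x) : Fin (n + 1) → ℝ) P
    rw [hv, hP _ (hW hx)] at h1
    exact_mod_cast h1
  exact ⟨soloInformedBox n q, isOpen_soloInformedBox n q, soloInformedCube_subset_box hq1, hW,
    soloInformed_isSemialgebraicFunOn_of_aeval_eq_zero hP0 (isOpen_soloInformedBox n q)
      (isSemialgebraic_soloInformedBox n q) hGc hPG⟩

/-- **THEOREM D_A with LEMMA Q discharged.** Ayoub's conjecture for the real sub-presentation and
the presentation-by-moves statement imply the Kontsevich–Zagier period conjecture (in the form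
`KontsevichZagierPeriods`: equal rational absolutely convergent integrals are move-equivalent).
[cite: Ayoub2014, Conj. 7, Prop. 11, Rem. 13] -/
theorem soloInformed_ayoubTransfer₂ (hP : SoloInformedAyoubPresentation)
    (hA : SoloInformedAyoubKZeff) : KontsevichZagierPeriods :=
  soloInformed_ayoubTransfer soloInformed_ayoubLemmaQ hP hA

end Summit.KontsevichZagierPeriods.KontsevichZagierPeriods.Theorems
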